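import Mathlib

/-!
# The injection behind the block lemma (Lemma C of proofs/MINE1-RSTARM-PROOF.md)

Dossier proofs/MINE1-theoremS.md, Addendum 39, Step 1 (the block lemma (BNT)), and
proofs/MINE1-RSTARM-PROOF.md §5. In the proof of Theorem (R*-M) proper the block lemma
`|Λ ∩ 𝒬| ≤ |T_u ∩ 𝒬|` is obtained from the map `g ↦ g ∆ ρ*` (symmetric difference with the
common part `ρ* = ⋂_m (u ∩ R*(K_m))` of the addable parts at the outside vertices). This module
isolates the finite set algebra of that step:

* `sdiff_mem_of_forall_exists_subset`: if every member of an up-set `U` lying inside `u` contains a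
  member of `U` inside `ρ` (the minimal elements of `U ∩ 2^u` lie in `2^ρ`), then for every `g` with
  `u \ g ∈ U` also `ρ \ g ∈ U` — this is how the structure `Λ = 2^{u∖ρ} ⊕ (ρ − (U ∩ 2^ρ))` of the
  block link enters (Addendum 39 (1b));
* `symmDiff_mem_inter_of_mem_inter`: with `Q` a down-set, `U` an up-set, `ρ \ g ∈ U` for every
  `g ∈ Λ` and `g ∪ ρ ∈ Q` for every `g ∈ Λ ∩ Q`, the set `g ∆ ρ` lies in `Q ∩ U` for every
  `g ∈ Λ ∩ Q` (Addendum 39 (1d));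
* `card_inter_le_card_inter_of_symmDiff`: hence `|Λ ∩ Q| ≤ |Q ∩ U|`, since `g ↦ g ∆ ρ` is injective.

In the instance, `Q = ↓P^out` (the faces below an outside trace), `U` the up-set of the instance,
`Λ` the link of `ū` in `L'`; `g ∪ ρ* ∈ Q` comes from Theorem (NT)(2) (`union_Rstar_mem_partner`):
`g ∪ ρ*` lies below the trace of the member `y ∪ R*(K_m)`; and `Q ∩ U = T_u ∩ ↓P^out = K⁺`.
-/

namespace PercRepro.MSTight

open Finset
open scoped symmDiff

variable {α : Type*} [DecidableEq α]

/-- If every member of `U` inside `u` contains a member of `U` inside `ρ` (the minimal members of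
`U` inside `u` lie inside `ρ`) and `U` is an up-set, then `u \ g ∈ U` implies `ρ \ g ∈ U`. -/
theorem sdiff_mem_of_forall_exists_subset {U : Finset (Finset α)} {u ρ : Finset α}
    (hU : ∀ x ∈ U, ∀ y, x ⊆ y → y ∈ U)
    (hmin : ∀ x ∈ U, x ⊆ u → ∃ z ∈ U, z ⊆ x ∧ z ⊆ ρ) {g : Finset α} (hg : u \ g ∈ U) :
    ρ \ g ∈ U := by
  obtain ⟨z, hzU, hzx, hzρ⟩ := hmin (u \ g) hg sdiff_subset
  refine hU z hzU _ ?_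
  intro a ha
  have h1 := hzx ha
  rw [mem_sdiff] at h1 ⊢
  exact ⟨hzρ ha, h1.2⟩

/-- The symmetric difference `g ∆ ρ` of a `g ∈ Λ ∩ Q` lies in `Q ∩ U`: it is below `g ∪ ρ ∈ Q`
(`Q` a down-set) and above `ρ \ g ∈ U` (`U` an up-set). -/
theorem symmDiff_mem_inter_of_mem_inter {Λ Q U : Finset (Finset α)} {ρ : Finset α}
    (hQ : ∀ x ∈ Q, ∀ y, y ⊆ x → y ∈ Q) (hU : ∀ x ∈ U, ∀ y, x ⊆ y → y ∈ U)
    (hΛ : ∀ g ∈ Λ, ρ \ g ∈ U) (hΛQ : ∀ g ∈ Λ, g ∈ Q → g ∪ ρ ∈ Q)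
    {g : Finset α} (hg : g ∈ Λ ∩ Q) : g ∆ ρ ∈ Q ∩ U := by
  rw [mem_inter] at hg ⊢
  obtain ⟨hgΛ, hgQ⟩ := hg
  refine ⟨hQ _ (hΛQ g hgΛ hgQ) _ ?_, hU _ (hΛ g hgΛ) _ ?_⟩
  · intro a ha
    rw [mem_symmDiff] at ha
    rw [mem_union]
    rcases ha with ⟨h, _⟩ | ⟨h, _⟩
    · exact Or.inl h
    · exact Or.inr h
  · intro a ha
    rw [mem_sdiff] at ha
    rw [mem_symmDiff]
    exact Or.inr ⟨ha.1, ha.2⟩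

/-- **The block injection.** `g ↦ g ∆ ρ` is injective and maps `Λ ∩ Q` into `Q ∩ U`, so
`|Λ ∩ Q| ≤ |Q ∩ U|`. -/
theorem card_inter_le_card_inter_of_symmDiff {Λ Q U : Finset (Finset α)} {ρ : Finset α}
    (hQ : ∀ x ∈ Q, ∀ y, y ⊆ x → y ∈ Q) (hU : ∀ x ∈ U, ∀ y, x ⊆ y → y ∈ U)
    (hΛ : ∀ g ∈ Λ, ρ \ g ∈ U) (hΛQ : ∀ g ∈ Λ, g ∈ Q → g ∪ ρ ∈ Q) :
    (Λ ∩ Q).card ≤ (Q ∩ U).card := by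
  refine card_le_card_of_injOn (fun g => g ∆ ρ) ?_ ?_
  · intro g hg
    rw [mem_coe] at hg ⊢
    exact symmDiff_mem_inter_of_mem_inter hQ hU hΛ hΛQ hg
  · intro g _ g' _ h
    have h' : g ∆ ρ ∆ ρ = g' ∆ ρ ∆ ρ := by
      simp only at h
      rw [h]
    simpa only [symmDiff_symmDiff_cancel_right] using h'

/-- The block lemma in the form used by the merge (Addendum 39, Step 2): with `K⁺ := Q ∩ U`, the
slack `|Λ ∩ Q| − |K⁺|` of the merged data is `≤ 0`. -/
theorem card_inter_le_card_of_symmDiff {Λ Q U : Finset (Finset α)} {ρ : Finset α}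
    (hQ : ∀ x ∈ Q, ∀ y, y ⊆ x → y ∈ Q) (hU : ∀ x ∈ U, ∀ y, x ⊆ y → y ∈ U)
    (hΛ : ∀ g ∈ Λ, ρ \ g ∈ U) (hΛQ : ∀ g ∈ Λ, g ∈ Q → g ∪ ρ ∈ Q) :
    (Λ ∩ Q).card ≤ (Q.filter fun k => k ∈ U).card := by
  have e : Q.filter (fun k => k ∈ U) = Q ∩ U := by
    ext k
    simp [mem_filter, mem_inter]
  rw [e]
  exact card_inter_le_card_inter_of_symmDiff hQ hU hΛ hΛQ

end PercRepro.MSTight
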